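import Mathlib

/-!
# Semigroup floor — the abstract graded-algebra core (`stub_gradedFloor`)

In a commutative `ℂ`-algebra `R`, let `S : ℕ → Submodule ℂ R` be a multiplicative `ℕ`-filtration
(`1 ∈ S 0`, `S a * S b ≤ S (a + b)`).  If `S 1` contains `D + 1` algebraically independent elements
`F₀, …, F_D`, then for every `k` the `C(k + D, D)` degree-`k` monomials `∏ F_i ^ e_i` lie in `S k`
and are linearly independent (algebraic independence is injectivity of `MvPolynomial.aeval F`, and
distinct monomials of `MvPolynomial (Fin (D + 1)) ℂ` are linearly independent), so
`C(k + D, D) ≤ dim S k` whenever `S k` is finite-dimensional.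

The degree-`k` monomials are indexed by the symmetric power `Sym (Fin (D + 1)) k` (stars and bars,
`Sym.card_sym_eq_choose`), transported to exponent vectors by `Multiset.toFinsupp`.
-/

set_option linter.dupNamespace false

namespace Summit.ValiantsHypothesis.ValiantsHypothesis.Theorems.ValuativeFlip

noncomputable section

open MvPolynomial

/-- In a multiplicative `ℕ`-filtration `S` (`1 ∈ S 0`, `S a * S b ≤ S (a + b)`), the evaluation at a
family `F` of elements of `S 1` of the monomial with exponent vector `e` lies in `S |e|`, where
`|e| = e.sum fun _ => id` is the total degree. -/
theorem aeval_monomial_mem_filtration {R : Type} [CommRing R] [Algebra ℂ R]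
    (S : ℕ → Submodule ℂ R) (h1 : (1 : R) ∈ S 0) (hmul : ∀ a b : ℕ, S a * S b ≤ S (a + b))
    {ι : Type} (F : ι → R) (hF : ∀ i, F i ∈ S 1) (e : ι →₀ ℕ) :
    MvPolynomial.aeval F (monomial e (1 : ℂ)) ∈ S (e.sum fun _ => id) := by
  haveI : SetLike.GradedMonoid S :=
    { one_mem := h1
      mul_mem := fun a b _ _ ha hb => hmul a b (Submodule.mul_mem_mul ha hb) }
  rw [MvPolynomial.aeval_monomial, map_one, one_mul]
  have h := SetLike.prod_pow_mem_graded S (fun _ => (1 : ℕ)) F (F := e.support) (⇑e)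
    (fun i _ => hF i)
  simp only [smul_eq_mul, mul_one] at h
  exact h

/-- **Semigroup floor, abstract form.**  In a commutative `ℂ`-algebra `R`, let
`S : ℕ → Submodule ℂ R` be multiplicative (`1 ∈ S 0`, `S a * S b ≤ S (a + b)`).  If `S 1` contains
`D + 1` algebraically independent elements `F₀, …, F_D`, then for every `k` the degree-`k` monomials
`∏ F_i ^ e_i` (`Σ e_i = k`; there are `C(k + D, D)` of them) lie in `S k` and are linearly independent,
so `C(k + D, D) ≤ dim S k` whenever `S k` is finite-dimensional. -/
theorem stub_gradedFloor :
    ∀ {R : Type} [CommRing R] [Algebra ℂ R] (S : ℕ → Submodule ℂ R),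
      (1 : R) ∈ S 0 → (∀ a b : ℕ, S a * S b ≤ S (a + b)) →
      ∀ (D : ℕ) (F : Fin (D + 1) → R), (∀ i, F i ∈ S 1) → AlgebraicIndependent ℂ F →
      ∀ k : ℕ, FiniteDimensional ℂ ↥(S k) → (k + D).choose D ≤ Module.finrank ℂ ↥(S k) := by
  intro R _ _ S h1 hmul D F hF hind k _hfin
  -- exponent vectors of the degree-`k` monomials, indexed by the symmetric power
  have he : Function.Injective
      (fun s : Sym (Fin (D + 1)) k => Multiset.toFinsupp (s : Multiset (Fin (D + 1)))) :=
    fun s t hst => Sym.coe_injective (Multiset.toFinsupp.injective hst)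
  -- the evaluated monomials are linearly independent in `R`
  have hli : LinearIndependent ℂ (fun s : Sym (Fin (D + 1)) k =>
      MvPolynomial.aeval F
        (monomial (Multiset.toFinsupp (s : Multiset (Fin (D + 1)))) (1 : ℂ))) := by
    have h0 := (MvPolynomial.basisMonomials (Fin (D + 1)) ℂ).linearIndependent
    rw [MvPolynomial.coe_basisMonomials] at h0
    have hker : LinearMap.ker
        (MvPolynomial.aeval F : MvPolynomial (Fin (D + 1)) ℂ →ₐ[ℂ] R).toLinearMap = ⊥ :=
      LinearMap.ker_eq_bot_of_injective (by rw [AlgHom.coe_toLinearMap]; exact hind)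
    have h2 := (h0.comp _ he).map' _ hker
    rw [AlgHom.coe_toLinearMap] at h2
    exact h2
  -- ... and they lie in `S k`
  have hmem : ∀ s : Sym (Fin (D + 1)) k,
      MvPolynomial.aeval F
        (monomial (Multiset.toFinsupp (s : Multiset (Fin (D + 1)))) (1 : ℂ)) ∈ S k := by
    intro s
    have h := aeval_monomial_mem_filtration S h1 hmul F hF
      (Multiset.toFinsupp (s : Multiset (Fin (D + 1))))
    rwa [Multiset.toFinsupp_sum_eq, Sym.card_coe] at h
  -- restrict the family to the subspace `S k` and count
  have hli' : LinearIndependent ℂ (fun s : Sym (Fin (D + 1)) k => (⟨_, hmem s⟩ : ↥(S k))) := by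
    refine LinearIndependent.of_comp (S k).subtype ?_
    rw [Submodule.coe_subtype]
    exact hli
  have hcard := hli'.fintype_card_le_finrank
  rw [Sym.card_sym_eq_choose, Fintype.card_fin,
    show D + 1 + k - 1 = k + D by omega, Nat.choose_symm_add] at hcard
  exact hcard

end

end Summit.ValiantsHypothesis.ValiantsHypothesis.Theorems.ValuativeFlip
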